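import Summits.Ventures.PercRepro.ProfileGapMonoThresholdLongLineCount

/-!
# PercRepro — THE CO-RANK-3 THRESHOLD FAMILY ON EVERY FINITE MATROID: `(I_t)` at `q = 3` for every `t ≥ 2`
(p5, gen 29; `proofs/P5-GM1.md` §38; announced INBOX 13743)

Assembly by strong induction on `#E` (`t ≥ 3`; `t = 2` is the row `(2, 3)` of the tree, `t = 3` its complement):
a loop is deleted (`thresholdIneq_of_loop`), a point of a parallel pair is deletion-monotone
(`delMonoT_of_parallel` with the co-rank-`2` theorem `thresholdIneq_two`), a coloop reduces to the deletion at
`t − 1` and co-rank `2` (`thresholdIneq_of_coloop`), and a simple coloop-free matroid is either of rank `≤ 2`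
(empty family), of nullity `≤ 2` (`thresholdIneq_three_of_nullity_le_two`), or covered by the long-line count
(`thresholdIneq_three_of_long`).  **`thresholdIneq_three_all`**.  Consequences: the coloop band case
**`starQ_three_four`** — `(★_3)` at the level `u = 4` for every finite matroid and every point — and
**`gapMonoQ_coloop_three_four`** — `(GM)_3` at every coloop at the level `u = 4` (`gapMonoQ_of_coloop_of_starQ` with
the trivial row `(3, 3)`), the instance §32 named as the one that moves S5 most.
-/

open scoped Matroid

namespace PercRepro.Cogirth

open Finset ThmH Skew Shadow Profile

variable {α : Type} [DecidableEq α]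

section All

/-- **THE CO-RANK-3 THRESHOLD FAMILY ON EVERY FINITE MATROID**: `ThresholdIneq N 3 t` for every `t ≥ 2`. -/
theorem thresholdIneq_three_all (N : Matroid α) [N.Finite] {t : ℕ} (ht : 2 ≤ t) : ThresholdIneq N 3 t := by
  rcases Nat.lt_or_ge t 3 with ht2 | ht3
  · -- `t = 2`: the row `(2, 3)`
    have h2 : t = 2 := by omega
    subst h2
    exact thresholdIneq_row_of_le_three N (by norm_num) (by norm_num)
  suffices H : ∀ n, ∀ (N : Matroid α) [N.Finite], (gr N).card = n → ∀ t : ℕ, 3 ≤ t →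
      ThresholdIneq N 3 t from H _ N rfl t ht3
  intro n
  induction n using Nat.strong_induction_on with
  | _ n ih =>
  intro N _ hn t ht
  by_cases hloop : ∃ ℓ ∈ gr N, rk N {ℓ} = 0
  · -- a loop
    obtain ⟨ℓ, hℓ, h0⟩ := hloop
    have hpos : 0 < (gr N).card := card_pos.2 ⟨ℓ, hℓ⟩
    refine thresholdIneq_of_loop hℓ h0 (ih _ ?_ _ rfl t ht)
    rw [gr_delete', card_erase_of_mem hℓ]
    omega
  push Not at hloop
  have hone : ∀ x ∈ gr N, rk N {x} = 1 := by
    intro x hx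
    have hle : rk N {x} ≤ ({x} : Finset α).card := rk_le_card _
    rw [card_singleton] at hle
    have := hloop x hx
    omega
  by_cases hpar : ∃ z ∈ gr N, ∃ z' ∈ gr N, z ≠ z' ∧ rk N {z, z'} = 1
  · -- a parallel pair
    obtain ⟨z, hz, z', hz', hzz', h1⟩ := hpar
    have hdel : ThresholdIneq (N ＼ ({z} : Set α) ／ ({z'} : Set α)) (3 - 1) (t - 1) :=
      thresholdIneq_two _ (by omega)
    have hpos : 0 < (gr N).card := card_pos.2 ⟨z, hz⟩
    refine thresholdIneq_of_delMonoT
      (delMonoT_of_parallel hz hz' hzz' (hone z hz) (hone z' hz') h1 (by norm_num) (by omega) hdel) ?_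
    refine ih _ ?_ _ rfl t ht
    rw [gr_delete', card_erase_of_mem hz]
    omega
  push Not at hpar
  have hpair : ∀ x ∈ gr N, ∀ y ∈ gr N, x ≠ y → rk N {x, y} = 2 := by
    intro x hx y hy hxy
    have hne1 := hpar x hx y hy hxy
    have hle : rk N {x, y} ≤ ({x, y} : Finset α).card := rk_le_card _
    rw [card_pair hxy] at hle
    have hmono : rk N {x} ≤ rk N {x, y} := rk_mono' (singleton_subset_iff.2 (mem_insert_self _ _))
    have := hone x hx
    omega
  by_cases hcol : ∃ z ∈ gr N, rk N ((gr N).erase z) + 1 = rk N (gr N)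
  · -- a coloop: the deletion at `t − 1` (the row `(2, 3)` when `t = 3`) and at co-rank `2`
    obtain ⟨z, hz, hzc⟩ := hcol
    have hpos : 0 < (gr N).card := card_pos.2 ⟨z, hz⟩
    have hsmall : (gr (N ＼ ({z} : Set α))).card < n := by
      rw [gr_delete', card_erase_of_mem hz]
      omega
    have h1 : ThresholdIneq (N ＼ ({z} : Set α)) 3 (t - 1) := by
      rcases Nat.lt_or_ge (t - 1) 3 with h | h
      · have h2 : t - 1 = 2 := by omega
        rw [h2]
        exact thresholdIneq_row_of_le_three _ (by norm_num) (by norm_num)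
      · exact ih _ hsmall _ rfl (t - 1) h
    have h2 : ThresholdIneq (N ＼ ({z} : Set α)) (3 - 1) t := thresholdIneq_two _ (by omega)
    exact thresholdIneq_of_coloop hz hzc (by norm_num) (by omega) h1 h2
  push Not at hcol
  have hcf : ∀ z ∈ gr N, rk N ((gr N).erase z) = rk N (gr N) := by
    intro z hz
    have h := hcol z hz
    have := rk_le_rk_erase_add_one (M := N) (Subset.refl _) hz
    have := rk_mono' (M := N) (erase_subset z (gr N))
    omega
  -- simple and coloop-free
  rcases Nat.lt_or_ge (rk N (gr N)) 3 with hR | hR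
  · -- rank `≤ 2`: the family is empty
    unfold ThresholdIneq thresholdSum
    have hzero : ∀ B ∈ Rq N (3 - 1), (if t + 1 ≤ rk N (gr N \ B) then rk N (gr N \ B) else 0) = 0 := by
      intro B _
      rw [if_neg]
      have := rk_mono' (M := N) (sdiff_subset : gr N \ B ⊆ gr N)
      omega
    rw [sum_congr rfl hzero, sum_const_zero]
    exact Nat.zero_le _
  rcases Nat.lt_or_ge (gr N).card (rk N (gr N) + 3) with hnu | hnu
  · exact thresholdIneq_three_of_nullity_le_two hcf (by omega) (by omega)
  · exact thresholdIneq_three_of_long hpair hcf hR hnu t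

/-- **`(★_3)` at the level `u = 4` on every finite matroid, at every point** — the coloop band case of the hard
rule's dispatch at co-rank `3` (§21(a)), unconditionally. -/
theorem starQ_three_four (M : Matroid α) [M.Finite] (z : α) : StarQ M z 3 4 :=
  (starQ_succ_iff_thresholdIneq (by norm_num)).2 (thresholdIneq_three_all _ (by norm_num))

/-- **`(GM)_3` at every coloop at the level `u = 4`**, on every finite matroid — the instance §32 named as the one
that moves S5 most (`gapMonoQ_of_coloop_of_starQ` with the trivial row `(3, 3)` of the deletion). -/
theorem gapMonoQ_coloop_three_four {M : Matroid α} [M.Finite] {z : α} (hz : z ∈ gr M)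
    (hzc : rk M ((gr M).erase z) + 1 = rk M (gr M)) : GapMonoQ M z 3 4 :=
  gapMonoQ_of_coloop_of_starQ hz hzc (by norm_num) (by norm_num)
    (profileIneqMinusQ_self (M ＼ ({z} : Set α)) 3) (starQ_three_four M z)

end All

end PercRepro.Cogirth
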